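import Literature.Barriers.Parity.SiegelZeroQuadraticPolynomialsMainEstimate
import Literature.Barriers.Parity.SiegelZeroQuadraticPolynomialsRelError
import Literature.Barriers.Parity.SiegelZeroQuadraticPolynomialsTheorem4Prep
import HarnessLib

/-!
# Granville–Mollin's Theorem 4: the core estimate for one discriminant

Topic `Literature/Barriers/Parity`, the assembly of the proof of
`Literature.Barriers.Parity.GranvilleMollin2000_thm4` (Granville–Mollin, *Rabinowitsch revisited*,
Acta Arith. 96 (2000), Theorem 4) for a single `d = −q`, `q ≡ 3 (mod 8)`: given the two analytic
inputs instantiated at `d` (the (5.5)-type bound with constant `K'` on `[q^{9.5}, q^η)` and the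
Heath-Brown bound with constant `K₁`), the parameters `ε` (`y = q^ε`), `δ` (`N ≤ q^{δη}`), and `q`
large in terms of `ε, K₁` (`log q ≥ 4/ε`, `log log q ≥ 4K₁²/ε²`, `q ≥ 256`), the main estimate
`abs_polyPrimeCount_sub_mul_le'`, the bookkeeping `relError_le` and the parameter lemmas of
`…Theorem4Prep.lean` give `|π_{f_d}(N) − ϱ_d N| ≤ ϱ_d N (Cω e e^{−5/ε} + 4e(1+Cω)K'δ/log 2 + G(q))`
(`thm4_core`). Everything is PROVED; no definition is introduced. The quantifier bookkeeping
(choice of `ε, δ, d₀`, extraction of the constants from the named facts, the trivial class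
`d ≡ 1 (mod 8)`) is `SiegelZeroQuadraticPolynomialsTheorem4.lean`.

[cite: GranvilleMollin2000, Theorem 4, §6A–6B]
-/

noncomputable section

open Finset Real Polynomial
open Literature.NumberTheory.Sieve

namespace Literature.Barriers.Parity

/-- `e² ≤ 256` and `54 ≤ e⁴` (numerics). [folklore] -/
theorem exp_two_le_and_le_exp_four : Real.exp 2 ≤ 256 ∧ (54 : ℝ) ≤ Real.exp 4 := by
  have h1 : Real.exp 1 < 2.7182818286 := Real.exp_one_lt_d9
  have h2 : 2.7182818283 < Real.exp 1 := Real.exp_one_gt_d9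
  have h0 : 0 < Real.exp 1 := Real.exp_pos 1
  constructor
  · rw [show (2 : ℝ) = 1 + 1 by norm_num, Real.exp_add]; nlinarith
  · have : Real.exp 4 = (Real.exp 1) ^ 4 := by rw [← Real.exp_nat_mul]; norm_num
    rw [this]
    have h3 : (2.7182818283 : ℝ) ^ 4 ≤ Real.exp 1 ^ 4 := pow_le_pow_left₀ (by norm_num) h2.le 4
    nlinarith

set_option maxHeartbeats 800000 in
/-- **Theorem 4 for one discriminant, explicit form.** For `d = −q`, `q ≡ 3 (mod 8)`, with
`L = log q`, `L ≤ η`, `0 < ε ≤ 1/100`, `0 < δ ≤ 1/4`, `K', K₁ ≥ 1`, `q ≥ 256`, `εL ≥ 4`,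
`log L ≥ 4K₁²/ε²`, `q^{10} ≤ N ≤ q^{δη}`, the (5.5)-type input
`∑_{p ≤ t} ω(p) log p ≤ K' t log t/(ηL)` for `q^{9.5} ≤ t < q^η` and the Heath-Brown input
`∑_{p ≤ q^500} ω(p) log p/p ≤ K₁ L/√(log η)`:
`|π_{f_d}(N) − ϱ_d N| ≤ ϱ_d N (Cω e e^{−5/ε} + 4e(1 + Cω) K' δ/log 2 + G(ε, K', K₁; q))`
with the tail `G` of `relError_le`. [cite: GranvilleMollin2000, Theorem 4, §6A–6B] -/
theorem thm4_core {d : ℤ} {q N : ℕ} (hdq : d = -(q : ℤ)) (hq8 : q % 8 = 3)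
    {ε δ K' K₁ η : ℝ} (hε : 0 < ε) (hε1 : ε ≤ 1 / 100) (hδ : 0 < δ) (hδ1 : δ ≤ 1 / 4)
    (hK' : 1 ≤ K') (hK₁ : 1 ≤ K₁) (hq256 : (256 : ℝ) ≤ q)
    (hεL : 4 ≤ ε * Real.log q) (hLL : 4 * K₁ ^ 2 / ε ^ 2 ≤ Real.log (Real.log q))
    (hLη : Real.log q ≤ η)
    (hN1 : (q : ℝ) ^ (10 : ℝ) ≤ N) (hN2 : (N : ℝ) ≤ (q : ℝ) ^ (δ * η))
    (h55 : ∀ t : ℝ, (q : ℝ) ^ ((19 : ℝ) / 2) ≤ t → t < (q : ℝ) ^ η →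
      ∑ p ∈ Nat.primesLE ⌊t⌋₊, (polyRootCountMod ![rabinowitschPoly d] p : ℝ) * Real.log p ≤
        K' / (η * Real.log q) * (t * Real.log t))
    (hH : ∑ p ∈ Nat.primesLE ⌊(q : ℝ) ^ (500 : ℝ)⌋₊,
        (polyRootCountMod ![rabinowitschPoly d] p : ℝ) * Real.log p / p ≤
      K₁ * (Real.log q / Real.sqrt (Real.log η))) :
    |(polyPrimeCount ![rabinowitschPoly d] N : ℝ) - gmRho d * N| ≤
      gmRho d * N *
        (SieveSequence.flConst 2 (2 * Real.exp (17 + 12 / Real.log 2)) * Real.exp 1 * Real.exp (-(5 / ε)) +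
          4 * Real.exp 1 * (1 + SieveSequence.flConst 2 (2 * Real.exp (17 + 12 / Real.log 2))) * K' * δ /
            Real.log 2 +
          (Real.exp 33 * K₁ ^ 2 * ε ^ 2 * Real.log q ^ 4 / (q : ℝ) ^ (5 : ℝ) +
            2 * Real.exp 25 * K₁ ^ 2 * Real.log q ^ 2 * (q : ℝ) ^ (ε / 2) / (q : ℝ) ^ (10 : ℝ) +
            (132 + 192 * Real.exp 8 + 4 * (1 + SieveSequence.flConst 2 (2 * Real.exp (17 + 12 / Real.log 2)))) *
              K' * Real.exp 25 * (1 / Real.log q ^ 2 + K₁ ^ 2 / Real.log (Real.log q)) +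
            (1 + SieveSequence.flConst 2 (2 * Real.exp (17 + 12 / Real.log 2))) * Real.exp 1 * K₁ *
              (1 / ε + 2) / Real.sqrt (Real.log (Real.log q)) +
            17 * Real.exp 33 * ε ^ 2 * K₁ ^ 2 * Real.log q ^ 4 / (q : ℝ) ^ ((1 : ℝ) / 4) +
            48 * (1 + SieveSequence.flConst 2 (2 * Real.exp (17 + 12 / Real.log 2))) * K' * ε *
              Real.sqrt (Real.exp 1 * (2 * Real.exp (17 + 12 / Real.log 2))) * Real.exp (25 / 2) *
              (1 / Real.log q + K₁ / Real.sqrt (Real.log (Real.log q))) / Real.log 2 +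
            2 * K₁ / (ε * Real.sqrt (Real.log (Real.log q))) + 32 / (q : ℝ) ^ ε)) := by
  obtain ⟨he2, he4⟩ := exp_two_le_and_le_exp_four
  -- parameters
  set L : ℝ := Real.log q with hL
  set s : ℝ := Real.sqrt (Real.log η) with hs
  set y : ℝ := (q : ℝ) ^ ε with hy
  set Kc : ℝ := K' / (η * L) with hKc
  set H : ℝ := K₁ * L / s with hH'
  set M : ℕ := ⌊4 * Real.log y / Real.log 2⌋₊ with hM
  set Q95 : ℝ := (q : ℝ) ^ ((19 : ℝ) / 2) with hQ95
  -- basic sizes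
  have hq0 : (0 : ℝ) < q := by linarith
  have hq1 : (1 : ℝ) < q := by linarith
  have hqe2 : Real.exp 2 ≤ q := he2.trans hq256
  have hL2 : 2 ≤ L := by rw [hL, Real.le_log_iff_exp_le hq0]; exact hqe2
  have hL0 : 0 < L := by linarith
  have hη2 : 2 ≤ η := hL2.trans hLη
  have hη0 : 0 < η := by linarith
  have hε100 : ε ≤ 1 := by linarith
  have hK'0 : 0 < K' := by linarith
  have hK₁0 : 0 < K₁ := by linarith
  have hlog2 : 0 < Real.log 2 := Real.log_pos one_lt_two
  have hlog2' : Real.log 2 < 1 := by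
    have := Real.log_two_lt_d9; linarith
  -- `log L ≥ 4K₁²/ε² ≥ 4`, so `L ≥ e⁴`, `log η ≥ log L ≥ 4K₁²`
  have hK₁ε : 4 * K₁ ^ 2 ≤ 4 * K₁ ^ 2 / ε ^ 2 := by
    rw [le_div_iff₀ (by positivity)]
    have : ε ^ 2 ≤ 1 := pow_le_one₀ hε.le hε100
    nlinarith [sq_nonneg K₁]
  have hLL4 : 4 * K₁ ^ 2 ≤ Real.log L := hK₁ε.trans hLL
  have hK₁4 : (4 : ℝ) ≤ 4 * K₁ ^ 2 := by nlinarith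
  have hlogL4 : 4 ≤ Real.log L := hK₁4.trans hLL4
  have hlogη : Real.log L ≤ Real.log η := Real.log_le_log hL0 hLη
  have hlogη4K : 4 * K₁ ^ 2 ≤ Real.log η := hLL4.trans hlogη
  have hlogη1 : 1 ≤ Real.log η := by linarith
  have hs1 : 1 ≤ s := by rw [hs, show (1 : ℝ) = Real.sqrt 1 by simp]; exact Real.sqrt_le_sqrt hlogη1
  have hs0 : 0 < s := by linarith
  -- `y = e^{εL} ≥ e⁴ ≥ 54`
  have hyexp : y = Real.exp (ε * L) := by rw [hy, Real.rpow_def_of_pos hq0, hL, mul_comm]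
  have hy54 : 54 ≤ y := by
    rw [hyexp]; exact he4.trans (Real.exp_le_exp.mpr hεL)
  have hy5 : 5 ≤ y := by linarith
  have hy2 : 2 ≤ y := by linarith
  have hy1 : 1 ≤ y := by linarith
  have hy0 : 0 < y := by linarith
  have hlogy : Real.log y = ε * L := by rw [hyexp, Real.log_exp]
  -- `y ≤ √q ≤ Q95`, `2 ≤ Q95`, `y ≤ Q95`
  have hysq : y ≤ Real.sqrt q := by
    rw [hy, Real.sqrt_eq_rpow]; exact Real.rpow_le_rpow_of_exponent_le hq1.le (by linarith)
  have hsqrt_le : Real.sqrt q ≤ Q95 := by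
    rw [Real.sqrt_eq_rpow]; exact Real.rpow_le_rpow_of_exponent_le hq1.le (by norm_num)
  have hyq : y ≤ Q95 := hysq.trans hsqrt_le
  have hq_le_Q : (q : ℝ) ≤ Q95 := by
    have := Real.rpow_le_rpow_of_exponent_le hq1.le (show (1 : ℝ) ≤ 19 / 2 by norm_num)
    rwa [Real.rpow_one] at this
  have hq95 : 2 ≤ Q95 := by linarith
  have hQ0 : 0 < Q95 := by linarith
  -- `N`: `q ≤ N`, `2 ≤ N`, `Q95 ≤ N/16`, `y ≤ √N`
  have hN0R : (0 : ℝ) < N := lt_of_lt_of_le (Real.rpow_pos_of_pos hq0 _) hN1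
  have hqNR : (q : ℝ) ≤ N := by
    have := Real.rpow_le_rpow_of_exponent_le hq1.le (show (1 : ℝ) ≤ 10 by norm_num)
    rw [Real.rpow_one] at this; exact this.trans hN1
  have hqN : q ≤ N := by exact_mod_cast hqNR
  have hN : 2 ≤ N := by
    have : (2 : ℝ) ≤ N := by linarith
    exact_mod_cast this
  have hsqrt16 : (16 : ℝ) ≤ Real.sqrt q := by
    rw [show (16 : ℝ) = Real.sqrt (16 ^ 2) by rw [Real.sqrt_sq (by norm_num)]]
    exact Real.sqrt_le_sqrt (by linarith)
  have hN16 : Q95 ≤ (N : ℝ) / 16 := by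
    rw [le_div_iff₀ (by norm_num)]
    have h1 : Q95 * Real.sqrt q = (q : ℝ) ^ (10 : ℝ) := by
      rw [hQ95, Real.sqrt_eq_rpow, ← Real.rpow_add hq0]; norm_num
    calc Q95 * 16 ≤ Q95 * Real.sqrt q := mul_le_mul_of_nonneg_left hsqrt16 hQ0.le
      _ = (q : ℝ) ^ (10 : ℝ) := h1
      _ ≤ N := hN1
  have hyN : y ≤ Real.sqrt N := hysq.trans (Real.sqrt_le_sqrt hqNR)
  -- `M`: `3 ≤ M`, `2^M ≤ y⁴ < 2^{M+1}`, `Q95 ≤ N/2^{M+1}`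
  have hMy := two_pow_floor_le hy1
  have hyM := lt_two_pow_floor_add_one hy0
  rw [← hM] at hMy hyM
  have hM3 : 3 ≤ M := by
    rw [hM]; refine Nat.le_floor ?_
    rw [hlogy]; push_cast
    rw [le_div_iff₀ hlog2]; nlinarith
  have hxM : Q95 ≤ (N : ℝ) / 2 ^ (M + 1) := by
    -- `2^{M+1} ≤ 2 y⁴ = 2 q^{4ε}` and `2 q^{4ε} Q95 ≤ q^{10} ≤ N` since `2 ≤ q^{1/2 - 4ε}`
    have h2M : (2 : ℝ) ^ (M + 1) ≤ 2 * y ^ 4 := by rw [pow_succ]; linarith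
    have h2M0 : (0 : ℝ) < 2 ^ (M + 1) := by positivity
    rw [le_div_iff₀ h2M0]
    have hy4 : y ^ 4 = (q : ℝ) ^ (4 * ε) := by
      rw [show (4 : ℝ) * ε = ε * 4 by ring, Real.rpow_mul hq0.le, hy,
        show (4 : ℝ) = ((4 : ℕ) : ℝ) by norm_num, Real.rpow_natCast]
    have hexp : 0 < 1 / 2 - 4 * ε := by linarith
    have hq14 : (2 : ℝ) ≤ (q : ℝ) ^ (1 / 2 - 4 * ε) := by
      have h4 : (2 : ℝ) ≤ (q : ℝ) ^ ((1 : ℝ) / 4) := by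
        have : (16 : ℝ) ^ ((1 : ℝ) / 4) ≤ (q : ℝ) ^ ((1 : ℝ) / 4) :=
          Real.rpow_le_rpow (by norm_num) (by linarith) (by norm_num)
        rwa [sixteen_rpow_quarter] at this
      exact h4.trans (Real.rpow_le_rpow_of_exponent_le hq1.le (by linarith))
    calc Q95 * 2 ^ (M + 1) ≤ Q95 * (2 * y ^ 4) := mul_le_mul_of_nonneg_left h2M hQ0.le
      _ = 2 * (Q95 * (q : ℝ) ^ (4 * ε)) := by rw [hy4]; ring
      _ ≤ (q : ℝ) ^ (1 / 2 - 4 * ε) * (Q95 * (q : ℝ) ^ (4 * ε)) :=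
          mul_le_mul_of_nonneg_right hq14 (by positivity)
      _ = (q : ℝ) ^ (10 : ℝ) := by
          rw [hQ95, ← Real.rpow_add hq0, ← Real.rpow_add hq0]; congr 1; ring
      _ ≤ N := hN1
  -- `2N < q^η`
  have hX₁ : 2 * (N : ℝ) < (q : ℝ) ^ η := by
    have h1 : (N : ℝ) ≤ (q : ℝ) ^ (η / 4) :=
      hN2.trans (Real.rpow_le_rpow_of_exponent_le hq1.le (by nlinarith))
    have h2 : (q : ℝ) ^ η = (q : ℝ) ^ (η / 4) * (q : ℝ) ^ (3 * η / 4) := by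
      rw [← Real.rpow_add hq0]; ring_nf
    have h3 : (q : ℝ) ≤ (q : ℝ) ^ (3 * η / 4) := by
      have := Real.rpow_le_rpow_of_exponent_le hq1.le (show (1 : ℝ) ≤ 3 * η / 4 by linarith)
      rwa [Real.rpow_one] at this
    have h4 : (0 : ℝ) < (q : ℝ) ^ (η / 4) := Real.rpow_pos_of_pos hq0 _
    rw [h2]
    calc 2 * (N : ℝ) ≤ 2 * (q : ℝ) ^ (η / 4) := by linarith
      _ < (q : ℝ) ^ (η / 4) * q := by nlinarith
      _ ≤ (q : ℝ) ^ (η / 4) * (q : ℝ) ^ (3 * η / 4) := mul_le_mul_of_nonneg_left h3 h4.le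
  -- the two inputs in the required shapes
  have hKc0 : 0 ≤ Kc := by rw [hKc]; positivity
  have h55' : ∀ t : ℝ, Q95 ≤ t → t < (q : ℝ) ^ η →
      ∑ p ∈ Nat.primesLE ⌊t⌋₊, (polyRootCountMod ![rabinowitschPoly d] p : ℝ) * Real.log p ≤
        Kc * (t * Real.log t) := fun t ht1 ht2 => h55 t ht1 ht2
  have hH0 : 0 ≤ H := by rw [hH']; positivity
  have hHle : ∑ p ∈ Nat.primesLE ⌊(q : ℝ) ^ (500 : ℝ)⌋₊,
      (polyRootCountMod ![rabinowitschPoly d] p : ℝ) * Real.log p / p ≤ H := by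
    rw [hH', mul_div_assoc]; exact hH
  -- the main estimate
  have hq7 : 7 ≤ q := by
    have : (7 : ℝ) ≤ q := by linarith
    exact_mod_cast this
  have habs := abs_polyPrimeCount_sub_mul_le' hdq hq8 hq7 hqN hN hy5 hysq hyN hKc0 h55' hX₁ hH0 hHle
    hq95 hyq hN16 hM3 hMy hyM hxM
  -- `ϱ ≤ V ≤ e ϱ`, `ϱ ≥ e^{-25} min(…)`, `t₀ ≤ 1`
  have hq25 : 25 ≤ q := by
    have : (25 : ℝ) ≤ q := by linarith
    exact_mod_cast this
  have hϱ0 : 0 < gmRho d := gmRho_pos hdq hq8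
  have hϱV := gmRho_le_prod_primesBelow hdq hq8 hysq
  have hϱlow := gmRho_ge_of_weighted hdq hq8 hq25 hK₁ hlogη4K hH
  have ht₀ : K₁ / (ε * s) + 16 / (q : ℝ) ^ ε ≤ 1 := by
    have h1 : K₁ / (ε * s) ≤ 1 / 2 := by
      rw [div_le_iff₀ (by positivity)]
      -- `2K₁ ≤ ε s` since `s ≥ √(log L) ≥ 2K₁/ε`
      have hsL : Real.sqrt (Real.log L) ≤ s := by rw [hs]; exact Real.sqrt_le_sqrt hlogη
      have h2 : 2 * K₁ / ε ≤ Real.sqrt (Real.log L) := by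
        rw [show 2 * K₁ / ε = Real.sqrt ((2 * K₁ / ε) ^ 2) by rw [Real.sqrt_sq (by positivity)]]
        refine Real.sqrt_le_sqrt ?_
        calc (2 * K₁ / ε) ^ 2 = 4 * K₁ ^ 2 / ε ^ 2 := by ring
          _ ≤ Real.log L := hLL
      have h3 : 2 * K₁ / ε ≤ s := h2.trans hsL
      rw [div_le_iff₀ hε] at h3
      linarith
    have h2 : 16 / (q : ℝ) ^ ε ≤ 1 / 2 := by
      rw [← hy, div_le_iff₀ hy0]; linarith
    linarith
  -- `V ≤ ϱ e^{t₀} ≤ e ϱ`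
  have hy1' : 1 < y := by linarith
  have hceil1 : 1 ≤ ⌈y⌉₊ := Nat.one_le_iff_ne_zero.mpr (Nat.ceil_pos.mpr hy0).ne'
  have ha₀y : y ≤ ((⌈y⌉₊ - 1 : ℕ) : ℝ) + 1 := by
    have : ((⌈y⌉₊ - 1 : ℕ) : ℝ) + 1 = ⌈y⌉₊ := by push_cast [Nat.cast_sub hceil1]; ring
    rw [this]; exact Nat.le_ceil y
  have hQ500 : ⌊Real.sqrt q⌋₊ ≤ ⌊(q : ℝ) ^ (500 : ℝ)⌋₊ := by
    refine Nat.floor_le_floor ?_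
    rw [Real.sqrt_eq_rpow]; exact Real.rpow_le_rpow_of_exponent_le hq1.le (by norm_num)
  have hT : ∑ p ∈ (Nat.primesLE ⌊Real.sqrt q⌋₊).filter (fun p => ⌈y⌉₊ - 1 < p),
      (polyRootCountMod ![rabinowitschPoly d] p : ℝ) / p ≤ H / Real.log y :=
    sum_omega_div_window_le_of_weighted hy1' ha₀y hQ500 hHle
  have hVexp := prod_primesBelow_le_gmRho_mul_exp hdq hq8 hy5 hysq hT
  have ht₀' : H / Real.log y + 16 / y ≤ 1 := by
    have : H / Real.log y + 16 / y = K₁ / (ε * s) + 16 / (q : ℝ) ^ ε := by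
      rw [hH', hlogy, hy]; field_simp
    rw [this]; exact ht₀
  have hVϱ : ∏ p ∈ Nat.primesBelow ⌈y⌉₊, (1 - (polyRootCountMod ![rabinowitschPoly d] p : ℝ) / p) ≤
      Real.exp 1 * gmRho d := by
    calc ∏ p ∈ Nat.primesBelow ⌈y⌉₊, (1 - (polyRootCountMod ![rabinowitschPoly d] p : ℝ) / p)
        ≤ gmRho d * Real.exp (H / Real.log y + 16 / y) := hVexp
      _ ≤ gmRho d * Real.exp 1 := mul_le_mul_of_nonneg_left (Real.exp_le_exp.mpr ht₀') hϱ0.le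
      _ = Real.exp 1 * gmRho d := mul_comm _ _
  -- `log N ≤ δ η L`
  have hlogN : Real.log N ≤ δ * η * L := by
    have := Real.log_le_log hN0R hN2
    rwa [Real.log_rpow hq0, ← hL] at this
  -- the relative error
  have hrel := relError_le (N := (N : ℝ)) (q := (q : ℝ)) (V := ∏ p ∈ Nat.primesBelow ⌈y⌉₊,
      (1 - (polyRootCountMod ![rabinowitschPoly d] p : ℝ) / p)) (ϱ := gmRho d)
    hqe2 hL hLη hs hs1 hε hε1 hδ hK' hK₁ hN1 hlogN hϱ0 hϱV hVϱ hϱlow hy hKc hH' ht₀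
  exact habs.trans hrel

end Literature.Barriers.Parity
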